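import Literature.IUT.HodgeArakelov.MonoThetaProjectiveProp16EllipticRef
import Literature.IUT.HodgeArakelov.MonoThetaCyclotomesBridgeEtTh
import Literature.IUT.HodgeArakelov.TemperedCurveXuu
import HarnessLib

/-!
# [IUTchII] Prop. 1.6 (ii), successor predicate `RefIsElliptic`: consequences and transport (proof-only companion)

PROOF-ONLY companion (theorems only; no `def`, no new named fact) of `MonoThetaProjectiveProp16EllipticRef.lean`
(abc-iut cell, wave-5 seat abc-iut-w5-d030 gen 9; DAG node **IUTchII:Prop1.6(ii)**, layer L6, outside the
[IUTchIII] Cor. 3.12 cone). S. Mochizuki, *Inter-universal Teichmüller Theory II*, kurims manuscript (Dec. 2020),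
§1, Prop. 1.6 (ii) p. 31 l. 34–41: "`Π ↦ {Π_{U_N}(Π) ↠ Π}` … such that when `Π = Π^tp_{X̲̲_k}`, the surjection
`Π_{U_N}(Π) ↠ Π` may be naturally identified with … “elliptic cuspidalization” … [cf. [AbsTopII], Corollary 3.3,
(iii)]" [claim: Mochizuki2012, status: disputed] (IUTchII §1 Prop 1.6 (ii), kurims p.31); [AbsTopII] Cor. 3.3 (iii)
pp. 68–69, Rmk. 3.3.3 p. 69 [cite: MochizukiAbsTopII2013, Cor 3.3 (iii) p.68]; [SemiAnbd] §6 pp. 69–74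
[cite: MochizukiSemiAnbd2006, §6 pp.69-74].

## What is proved (about the frozen output `EllipticCuspidalization S N P` and the predicate `RefIsElliptic`)

* `projRef_surjective` — the reference surjection of EVERY frozen output is onto (field `identified`);
  `refHom_surjective` — hence so is its tempered reading `Π^tp_U → Π^tp_X`;
* under `K.RefIsElliptic X U eX eU`: `refHom_continuous`; `isClosed_ker` (the kernel is a closed normal subgroup);
  `inertia_le_ker` (the inertia groups of the removed cusps die in `Π^tp_X`); **`exists_level`** — there is an
  [AbsTopII] Cor. 3.3 (iii) record OF LEVEL EXACTLY `N` (the label `N` is load-bearing under the predicate;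
  contrast `nonempty_iff_of_label`, p412824, for the bare output); `removed_not_cusp_image` ([AbsTopII] Cor. 3.3
  (iii)(c): removed cusps lie over NON-cuspidal points of `X` with the image decomposition group);
* **`RefIsElliptic.transport`** — the predicate is stable under the output's functorial transport
  `EllipticCuspidalization.transport` along `P ≃ₜ* P'`; `RefIsElliptic.range_aug_comp_refHom` / `exists_aug_refHom_eq`
  (v2) — the COMPOSITE augmentation `Π^tp_U ↠ Π^tp_X → G` has image exactly `G_k` (the bracket of Prop. 1.6 (ii));
* **`ThetaSetting.deltaTemp_map_refl_ofDoubleUnderline`** — AT THE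
  [EtTh] MODEL `S := ThetaSetting.ofDoubleUnderline C μ hC hS …` (abc-iut-L6 bridge B8) the setting's tempered group IS
  the tempered group of abc-iut-L6-t7's tempered curve `X̲̲_v = C.temperedCurveXuuOfLevelData …` ON THE NOSE
  (`eX := ContinuousMulEquiv.refl`), and clause (R0) of the predicate HOLDS there: `Δ^tp_X ↦ Δ^tp_{X̲̲_k}` (both are
  `Ker(Π^tp_X̲̲ → G_K)`). The remaining clauses need the punctured curve `U_X` (interface, MERGE debt).

HONEST SCOPE as in the statement file: a predicate and its bookkeeping; nothing is inhabited here; nothing takes a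
side on [IUTchIII] Cor. 3.12; typed ≠ proved for the series.
-/

open Topology
open scoped Pointwise

universe u

namespace Literature.IUT.HodgeArakelov

open Literature.AnabelianGeometry.SemiGraphs (TemperedCurve)
open Literature.AnabelianGeometry.AbsoluteAnabelian (FundamentalExtension)

namespace EllipticCuspidalization

variable {S : ThetaSetting.{u}} {N : ℕ+} {P P' : TopGroup.{u}}

/-- The reference surjection `projRef : Π^tp_{U_N} → Π^tp_{X̲̲_k}` of every frozen output IS surjective (it is
identified with the surjection `Π_{U_N}(Π) ↠ Π` by the field `identified`).
[claim: Mochizuki2012, status: disputed] (IUTchII §1 Prop 1.6 (ii), kurims p.31) -/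
theorem projRef_surjective (K : EllipticCuspidalization S N P) : Function.Surjective K.projRef := by
  obtain ⟨e, eU, heU⟩ := K.identified
  intro z
  obtain ⟨y, hy⟩ := K.proj_surjective (e.symm z)
  refine ⟨eU y, ?_⟩
  rw [heU, hy, ContinuousMulEquiv.apply_symm_apply]

section Ref

variable {p : ℕ} [Fact p.Prime]

/-- The tempered reading `Π^tp_U → Π^tp_X` of the reference surjection is surjective.
[claim: Mochizuki2012, status: disputed] (IUTchII §1 Prop 1.6 (ii), kurims p.31) -/
theorem refHom_surjective (K : EllipticCuspidalization S N P) (X U : TemperedCurve p)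
    (eX : X.PiTemp ≃ₜ* S.PiX) (eU : U.PiTemp ≃ₜ* K.PiURef) : Function.Surjective (K.refHom X U eX eU) :=
  eX.symm.surjective.comp (K.projRef_surjective.comp eU.surjective)

namespace RefIsElliptic

variable {K : EllipticCuspidalization S N P} {X U : TemperedCurve p} {eX : X.PiTemp ≃ₜ* S.PiX}
  {eU : U.PiTemp ≃ₜ* K.PiURef}

/-- Under the predicate the tempered reading `Π^tp_U → Π^tp_X` is continuous.
[claim: Mochizuki2012, status: disputed] (IUTchII §1 Prop 1.6 (ii), kurims p.31) -/
theorem refHom_continuous (h : K.RefIsElliptic X U eX eU) : Continuous (K.refHom X U eX eU) :=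
  eX.symm.continuous.comp (h.continuous_projRef.comp eU.continuous)

/-- Under the predicate the kernel of `Π^tp_U ↠ Π^tp_X` is a CLOSED normal subgroup (a topological closure —
the `DLoc` shape of [SemiAnbd] §6). [cite: MochizukiSemiAnbd2006, §6 p.73] -/
theorem isClosed_ker (h : K.RefIsElliptic X U eX eU) : IsClosed ((K.refHom X U eX eU).ker : Set U.PiTemp) := by
  obtain ⟨R, -, hker, -⟩ := h.kernel_eq
  rw [hker]
  exact Subgroup.isClosed_topologicalClosure _

/-- Under the predicate the inertia groups of the removed cusps die in `Π^tp_X` (they lie in the kernel).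
[cite: MochizukiSemiAnbd2006, §6 p.73] -/
theorem inertia_le_ker (h : K.RefIsElliptic X U eX eU) :
    ∃ R : Set U.Pt, (∀ x ∈ R, U.IsCusp x) ∧ ∀ x ∈ R, U.inertia x ≤ (K.refHom X U eX eU).ker := by
  obtain ⟨R, hR, hker, -⟩ := h.kernel_eq
  refine ⟨R, hR, fun x hx g hg => ?_⟩
  rw [hker]
  refine Subgroup.le_topologicalClosure _ (Subgroup.subset_normalClosure ?_)
  exact Set.mem_biUnion hx hg

/-- **The label `N` is load-bearing under the predicate**: there is an [AbsTopII] Cor. 3.3 (iii) record of level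
exactly `N` whose cuspidalisation `Π_{U_X} ↠ Π` is the completion of the reference surjection (contrast
`nonempty_iff_of_label`, p412824, for the bare output). [cite: MochizukiAbsTopII2013, Cor 3.3 (iii) p.68] -/
theorem exists_level (h : K.RefIsElliptic X U eX eU) :
    ∃ (E : FundamentalExtension.{0})
      (C : Literature.AnabelianGeometry.AbsoluteAnabelian.AbsTopII.EllipticCuspidalization E), C.N = (N : ℕ) := by
  obtain ⟨E, -, C, -, hN, -, -⟩ := h.elliptic
  exact ⟨E, C, hN⟩

/-- [AbsTopII] Cor. 3.3 (iii)(c) under the predicate: every removed cusp of `U` lies over a NON-cuspidal closed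
point of `X` whose decomposition group class contains the image of the cusp's decomposition group.
[cite: MochizukiAbsTopII2013, Cor 3.3 (iii) p.68] -/
theorem removed_not_cusp_image (h : K.RefIsElliptic X U eX eU) :
    ∃ R : Set U.Pt, (K.refHom X U eX eU).ker =
        (Subgroup.normalClosure (⋃ x ∈ R, (U.inertia x : Set U.PiTemp))).topologicalClosure ∧
      ∀ x ∈ R, ∃ y : X.Pt, ¬ X.IsCusp y ∧ X.IsDecompositionGroup ((U.decomp x).map (K.refHom X U eX eU)) := by
  obtain ⟨R, -, hker, hc⟩ := h.kernel_eq
  refine ⟨R, hker, fun x hx => ?_⟩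
  obtain ⟨y, hy, γ, hγ⟩ := hc x hx
  exact ⟨y, hy, y, γ, hγ⟩

/-- **TRANSPORT.** The predicate is stable under the output's functorial transport along `P ≃ₜ* P'` (the
reference datum and `projRef` do not move). [claim: Mochizuki2012, status: disputed] (IUTchII §1 Prop 1.6 (ii), kurims p.31) -/
theorem transport (h : K.RefIsElliptic X U eX eU) (f : P ≃ₜ* P') : (K.transport f).RefIsElliptic X U eX eU where
  deltaTemp_eq := h.deltaTemp_eq
  K_eq := h.K_eq
  continuous_projRef := h.continuous_projRef
  aug_comp := h.aug_comp
  kernel_eq := h.kernel_eq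
  elliptic := h.elliptic

/-- **The composite augmentation** (the bracket of Prop. 1.6 (ii): "so the augmentation `Π ↠ Π/Δ` determines, by
composition, an augmentation `Π_{U_N}(Π) ↠ Π/Δ`"): under the predicate, `Π^tp_U ↠ Π^tp_X → G_{ℚ_p}` has image EXACTLY
`G_k` — the composite of the cuspidalisation with the augmentation is again an augmentation onto the same Galois group
(`aug_comp` + the [SemiAnbd] §6 axiom `range_aug` of `U` + `K_eq`).
[claim: Mochizuki2012, status: disputed] (IUTchII §1 Prop 1.6 (ii), kurims p.31) -/
theorem range_aug_comp_refHom (h : K.RefIsElliptic X U eX eU) :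
    (X.aug.toMonoidHom.comp (K.refHom X U eX eU)).range = X.GK := by
  have hU : U.aug.toMonoidHom.range = U.K.fixingSubgroup := U.range_aug
  ext g
  constructor
  · rintro ⟨y, rfl⟩
    have hy : U.aug y ∈ U.aug.toMonoidHom.range := ⟨y, rfl⟩
    rw [hU, h.K_eq] at hy
    simpa [TemperedCurve.GK, h.aug_comp y] using hy
  · intro hg
    have hg' : g ∈ U.aug.toMonoidHom.range := by
      rw [hU, h.K_eq]
      exact hg
    obtain ⟨y, hy⟩ := hg'
    exact ⟨y, by simpa [h.aug_comp y] using hy⟩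

/-- Hence the composite augmentation `Π^tp_U → G_k` is SURJECTIVE onto `G_k` (as a map to the subgroup `G_k ≤ G_{ℚ_p}`):
every element of `G_k` lifts to `Π^tp_{U_N}`. [claim: Mochizuki2012, status: disputed] (IUTchII §1 Prop 1.6 (ii), kurims p.31) -/
theorem exists_aug_refHom_eq (h : K.RefIsElliptic X U eX eU) {g : Literature.AnabelianGeometry.SemiGraphs.GQp p}
    (hg : g ∈ X.GK) : ∃ y : U.PiTemp, X.aug (K.refHom X U eX eU y) = g := by
  have : g ∈ (X.aug.toMonoidHom.comp (K.refHom X U eX eU)).range := by rw [h.range_aug_comp_refHom]; exact hg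
  obtain ⟨y, hy⟩ := this
  exact ⟨y, hy⟩

end RefIsElliptic

end Ref

end EllipticCuspidalization

/-! ## Clause (R0) at the [EtTh] model (bridge B8 `ThetaSetting.ofDoubleUnderline`, tempered curve `X̲̲_v`) -/

namespace ThetaSetting

open Literature.AnabelianGeometry.EtaleTheta

variable {p : ℕ} [Fact p.Prime] {D : Literature.AnabelianGeometry.EtaleTheta.ThetaSetting p}
  {E : D.EtaleThetaData} {l : ℕ} (C : E.DoubleUnderline l) {N : ℕ+} (μ : D.CyclotomeMod l N)
  (hC : D.Compat) (hS : D.Sec2Hyps)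

/-- **Clause (R0) of `RefIsElliptic` HOLDS at the [EtTh] model** (the setting's `Π^tp_{X̲̲_k}` IS the tempered
group `C.Huu` of abc-iut-L6-t7's tempered curve `X̲̲_v = temperedCurveXuuOfLevelData …` ON THE NOSE, so `eX := refl`
type-checks): `Δ^tp_X = Ker(Π^tp_{X̲̲} → G_{ℚ_p})`
of the tempered curve `X̲̲_v` is carried onto the setting's `Δ^tp_{X̲̲_k} = Ker(S.aug)` (abc-iut-L2-t8's augmentation
`Π^tp_X̲̲ → G_K`, the corestriction of the same map). [cite: MochizukiEtTh2009, Def 2.13 p.47] -/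
theorem deltaTemp_map_refl_ofDoubleUnderline (hl : l.Prime) (hp2 : p ≠ 2) (hpl : p ≠ l)
    (hζ : ∃ ζ : D.K, IsPrimitiveRoot ζ (4 * l)) {η : (C.thetaEnvData μ hC hS).PiYdd → MuN p N}
    (hη : η ∈ (C.thetaEnvData μ hC hS).thetaCocycles) (d : D.toTemperedCurve.GroupLevelData) :
    (C.temperedCurveXuuOfLevelData hl.ne_zero d).DeltaTemp.map
        (ContinuousMulEquiv.refl _ :
          (C.temperedCurveXuuOfLevelData hl.ne_zero d).PiTemp ≃ₜ*
            (ofDoubleUnderline C μ hC hS hl hp2 hpl hζ hη).PiX).toMulEquiv.toMonoidHom =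
      (ofDoubleUnderline C μ hC hS hl hp2 hpl hζ hη).DeltaX := by
  ext x
  constructor
  · rintro ⟨y, hy, rfl⟩
    exact Subtype.ext hy
  · intro hx
    exact ⟨x, congrArg Subtype.val hx, rfl⟩

end ThetaSetting

end Literature.IUT.HodgeArakelov
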